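import Mathlib
import HarnessLib
import Literature.Analysis.FunctionSpaces.TorusScalarFourierSeries

/-!
# The Fourier TAIL of a smooth function on the flat torus beyond a frequency threshold: an explicit polynomial bound
# `Σ_{k : ∃ i, N ≤ 2|kᵢ|} ‖𝓕g(k)‖ ≤ D·(2π)^{-M}·(2/N)^{M−2d}·2^d·C_d` from `‖∂ⱼ^M g‖ ≤ D`

Topic `Literature/Analysis/Fourier`; namespace `Literature.Analysis.Fourier`.  A quantitative companion of
`Literature.Analysis.FunctionSpaces.Torus.summable_norm_mFourierCoeff_scalar` (TorusScalarFourierSeries): the same product-weight majorant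
`‖𝓕g(k)‖ ≤ D·|k_{j₀}|^{-M} ≤ …·∏ⱼ(1 + kⱼ²)⁻¹` (`j₀` the largest coordinate), keeping the gain `|k_{j₀}|^{-(M − 2d)} ≤ (2/N)^{M−2d}` on the tail
region `{k : ∃ i, N ≤ 2|kᵢ|}` (the ALIASED frequencies of the `N`-grid, …Fourier.TorusGridAliasingTail / TorusGridRiemannSum):

* `norm_mFourierCoeff_le_tail_prod` — the pointwise majorant with the tail gain;
* **`tsum_tail_norm_mFourierCoeff_le`** — the summed bound, constant `C_d = Σ_{k ∈ ℤ^d} ∏ⱼ(1 + kⱼ²)⁻¹` (summable: `Torus.summable_pi_prod_weight`);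
* `summable_tail_norm_mFourierCoeff` (plumbing).

Source: the decay `‖𝓕(∂ⱼ^M g)(k)‖ = (2π|kⱼ|)^M‖𝓕g(k)‖` [cite: Grafakos2014, Thm. 3.3.9] and the smoothness ⇒ decay discussion [cite: Grafakos2014, §3.3.3]
(L. Grafakos, *Classical Fourier Analysis*, 3rd ed., Springer 2014).  Used by the Hubbard `KLProgramme` (lane c4a-1, LAYER 2: the aliasing error of the
Brillouin-zone Riemann sum at scale `Λ` is `O((ΛL)^{-(M−4)}Λ^{-4})`).  Everything is proved; no definitions.
-/

noncomputable section

open Complex Finset MeasureTheory UnitAddTorus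
open Literature.Analysis.FunctionSpaces Literature.Analysis.FunctionSpaces.Torus

namespace Literature.Analysis.Fourier

variable {d : Type*} [Fintype d] [DecidableEq d]
variable {F : Type*} [NormedAddCommGroup F] [NormedSpace ℂ F] [CompleteSpace F]

/-- **Pointwise majorant with the tail gain.**  If `‖∂ⱼ^M g‖ ≤ D` for every coordinate `j` (`2d ≤ M`), then at every frequency `k` with some
`2|kᵢ| ≥ N ≥ 1`: `‖𝓕g(k)‖ ≤ D·(2π)^{-M}·(2/N)^{M−2d}·2^d·∏ⱼ(1 + kⱼ²)⁻¹`. [cite: Grafakos2014, Thm. 3.3.9] -/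
theorem norm_mFourierCoeff_le_tail_prod {g : UnitAddTorus d → F} (hg : IsSmooth g) {M : ℕ} (hM : 2 * Fintype.card d ≤ M) {D : ℝ}
    (hD : ∀ (j : d) (x : UnitAddTorus d), ‖((Torus.partialDeriv j)^[M] g) x‖ ≤ D) {N : ℕ} (hN : 1 ≤ N) {k : d → ℤ}
    (hk : ∃ i, (N : ℤ) ≤ 2 * |k i|) :
    ‖mFourierCoeff g k‖ ≤
      D / (2 * Real.pi) ^ M * (2 / (N : ℝ)) ^ (M - 2 * Fintype.card d) * (2 ^ Fintype.card d * ∏ j, (1 + (k j : ℝ) ^ 2)⁻¹) := by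
  obtain ⟨i₀, hi₀⟩ := hk
  have hD0 : 0 ≤ D := le_trans (norm_nonneg _) (hD i₀ 0)
  have hd : Nonempty d := ⟨i₀⟩
  obtain ⟨j₀, -, hj₀⟩ := Finset.exists_max_image Finset.univ (fun j => |(k j : ℝ)|) (Finset.univ_nonempty_iff.2 hd)
  -- the largest coordinate is at least `N/2 ≥ 1/2`, hence nonzero and `≥ 1`
  have hNR : (N : ℝ) / 2 ≤ |(k j₀ : ℝ)| := by
    have h1 : (N : ℝ) ≤ 2 * |(k i₀ : ℝ)| := by exact_mod_cast hi₀
    have h2 := hj₀ i₀ (Finset.mem_univ _)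
    linarith
  have hN1 : (1 : ℝ) ≤ N := by exact_mod_cast hN
  have hk0 : k j₀ ≠ 0 := by
    intro h
    rw [h, Int.cast_zero, abs_zero] at hNR
    linarith
  have hone : (1 : ℝ) ≤ |(k j₀ : ℝ)| := by exact_mod_cast Int.one_le_abs hk0
  have hpos : (0 : ℝ) < |(k j₀ : ℝ)| := by linarith
  -- decay from the `M`-th partial derivative in direction `j₀`
  have h1 : ‖mFourierCoeff g k‖ ≤ D / (2 * Real.pi * |(k j₀ : ℝ)|) ^ M :=
    Torus.norm_mFourierCoeff_le_of_partialDeriv_iterate hg j₀ M hk0 (hD j₀)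
  -- split `|k_{j₀}|^{-M} = |k_{j₀}|^{-(M-2d)} · ∏ⱼ |k_{j₀}|^{-2}`
  set m : ℕ := M - 2 * Fintype.card d with hm
  have hMm : M = m + 2 * Fintype.card d := by omega
  have hstep : ∀ j, (|(k j₀ : ℝ)| ^ 2)⁻¹ ≤ 2 * (1 + (k j : ℝ) ^ 2)⁻¹ := by
    intro j
    refine le_trans ?_ (Torus.inv_max_sq_le_two_mul (k j))
    rw [inv_le_inv₀ (by positivity) (by positivity)]
    exact pow_le_pow_left₀ (by positivity) (max_le hone (hj₀ j (Finset.mem_univ j))) 2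
  have htail : (|(k j₀ : ℝ)| ^ m)⁻¹ ≤ (2 / (N : ℝ)) ^ m := by
    rw [← inv_pow, show (2 : ℝ) / N = ((N : ℝ) / 2)⁻¹ by rw [inv_div]]
    exact pow_le_pow_left₀ (by positivity) ((inv_le_inv₀ hpos (by positivity)).2 hNR) m
  calc ‖mFourierCoeff g k‖ ≤ D / (2 * Real.pi * |(k j₀ : ℝ)|) ^ M := h1
    _ = D / (2 * Real.pi) ^ M * ((|(k j₀ : ℝ)| ^ m)⁻¹ * ∏ _j : d, (|(k j₀ : ℝ)| ^ 2)⁻¹) := by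
        have ha : |(k j₀ : ℝ)| ≠ 0 := hpos.ne'
        have key : |(k j₀ : ℝ)| ^ M = |(k j₀ : ℝ)| ^ m * (|(k j₀ : ℝ)| ^ 2) ^ Fintype.card d := by
          rw [hMm, pow_add, pow_mul]
        rw [Finset.prod_const, Finset.card_univ, mul_pow, key, inv_pow]
        have h2 : (|(k j₀ : ℝ)| ^ 2) ^ Fintype.card d ≠ 0 := pow_ne_zero _ (pow_ne_zero _ ha)
        have h3 : |(k j₀ : ℝ)| ^ m ≠ 0 := pow_ne_zero _ ha
        have h4 : (2 * Real.pi) ^ M ≠ 0 := pow_ne_zero _ (by positivity)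
        field_simp
    _ ≤ D / (2 * Real.pi) ^ M * ((2 / (N : ℝ)) ^ m * ∏ j : d, (2 * (1 + (k j : ℝ) ^ 2)⁻¹)) := by
        refine mul_le_mul_of_nonneg_left (mul_le_mul htail (Finset.prod_le_prod (fun _ _ => by positivity) fun j _ => hstep j)
          (Finset.prod_nonneg fun _ _ => by positivity) (by positivity)) (by positivity)
    _ = D / (2 * Real.pi) ^ M * (2 / (N : ℝ)) ^ m * (2 ^ Fintype.card d * ∏ j, (1 + (k j : ℝ) ^ 2)⁻¹) := by
        rw [Finset.prod_mul_distrib, Finset.prod_const, Finset.card_univ]; ring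

/-- The tail series is summable (plumbing). [cite: Grafakos2014, §3.3.3] -/
theorem summable_tail_norm_mFourierCoeff {g : UnitAddTorus d → F} (hg : IsSmooth g) (P : (d → ℤ) → Prop) [DecidablePred P] :
    Summable fun k : d → ℤ => (if P k then ‖mFourierCoeff g k‖ else 0) := by
  refine Summable.of_nonneg_of_le (fun k => by positivity) (fun k => ?_) (Torus.summable_norm_mFourierCoeff_scalar hg)
  split_ifs
  · exact le_rfl
  · exact norm_nonneg _

/-- **THE TAIL BOUND.**  If `‖∂ⱼ^M g‖ ≤ D` for every coordinate `j` (`2d ≤ M`) and `N ≥ 1`, then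
`Σ_{k : ∃ i, N ≤ 2|kᵢ|} ‖𝓕g(k)‖ ≤ D·(2π)^{-M}·(2/N)^{M−2d}·2^d·Σ_{k ∈ ℤ^d} ∏ⱼ(1 + kⱼ²)⁻¹` — polynomial decay in the threshold `N` at the rate
`N^{-(M−2d)}`, as fast as the smoothness allows. [cite: Grafakos2014, §3.3.3] -/
theorem tsum_tail_norm_mFourierCoeff_le [Nonempty d] {g : UnitAddTorus d → F} (hg : IsSmooth g) {M : ℕ} (hM : 2 * Fintype.card d ≤ M)
    {D : ℝ} (hD : ∀ (j : d) (x : UnitAddTorus d), ‖((Torus.partialDeriv j)^[M] g) x‖ ≤ D) {N : ℕ} (hN : 1 ≤ N) :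
    ∑' k : d → ℤ, (if ∃ i, (N : ℤ) ≤ 2 * |k i| then ‖mFourierCoeff g k‖ else 0) ≤
      D / (2 * Real.pi) ^ M * (2 / (N : ℝ)) ^ (M - 2 * Fintype.card d) *
        (2 ^ Fintype.card d * ∑' k : d → ℤ, ∏ j, (1 + (k j : ℝ) ^ 2)⁻¹) := by
  classical
  have hsw : Summable fun k : d → ℤ => ∏ j, (1 + (k j : ℝ) ^ 2)⁻¹ := by
    have h := Torus.summable_pi_prod_weight (d := d) (w := fun m : ℤ => (1 + (m : ℝ) ^ 2)⁻¹) summable_inv_one_add_sq_int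
      (fun m => by positivity)
    exact h
  obtain ⟨i₀⟩ := ‹Nonempty d›
  have hD0 : 0 ≤ D := le_trans (norm_nonneg _) (hD i₀ 0)
  have hpt : ∀ k : d → ℤ, (if ∃ i, (N : ℤ) ≤ 2 * |k i| then ‖mFourierCoeff g k‖ else 0) ≤
      (D / (2 * Real.pi) ^ M * (2 / (N : ℝ)) ^ (M - 2 * Fintype.card d) * 2 ^ Fintype.card d) * ∏ j, (1 + (k j : ℝ) ^ 2)⁻¹ := by
    intro k
    split_ifs with hk
    · exact (norm_mFourierCoeff_le_tail_prod hg hM hD hN hk).trans (le_of_eq (by ring))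
    · exact mul_nonneg (by positivity) (Finset.prod_nonneg fun _ _ => by positivity)
  refine (Summable.tsum_le_tsum hpt (summable_tail_norm_mFourierCoeff hg _) (hsw.mul_left _)).trans (le_of_eq ?_)
  rw [tsum_mul_left]
  ring

/-! ## §2 The WEIGHTED tail `Σ_{tail} ‖𝓕g(k)‖·(1 + |k|₁)^j` (derivative weights of order `j`; appended 2026-08-27, lane c4a-1 g4)

For aliasing bounds on DERIVATIVES of order `j` of grid interpolants (Hubbard `KLProgramme`, (R59bl) generic aliasing-jet lemma) one needs the tail with
the polynomial weight `(1 + Σᵢ|kᵢ|)^j`; `j` more powers of the largest coordinate are spent on the weight, so the gain becomes `(2/N)^{M − j − 2d}` under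
`2d + j ≤ M`. -/

omit [DecidableEq d] in
/-- On the tail region the `ℓ¹` weight is dominated by the largest coordinate: `1 + Σᵢ|kᵢ| ≤ (card d + 1)·|k_{j₀}|` whenever `|k_{j₀}| ≥ 1` is the
largest `|kᵢ|`. [cite: Grafakos2014, §3.3.3] -/
theorem one_add_sum_abs_le_mul_max (k : d → ℤ) (j₀ : d) (hmax : ∀ j, |(k j : ℝ)| ≤ |(k j₀ : ℝ)|) (hone : (1 : ℝ) ≤ |(k j₀ : ℝ)|) :
    1 + ∑ i, |(k i : ℝ)| ≤ ((Fintype.card d : ℝ) + 1) * |(k j₀ : ℝ)| := by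
  have hs : ∑ i, |(k i : ℝ)| ≤ ∑ _i : d, |(k j₀ : ℝ)| := Finset.sum_le_sum fun i _ => hmax i
  rw [Finset.sum_const, Finset.card_univ, nsmul_eq_mul] at hs
  linarith

/-- **Pointwise WEIGHTED majorant with the tail gain.**  If `‖∂ⱼ^M g‖ ≤ D` for every coordinate `j` (`2d + j ≤ M`), then at every frequency `k` with some
`2|kᵢ| ≥ N ≥ 1`: `‖𝓕g(k)‖·(1 + Σᵢ|kᵢ|)^j ≤ (card d + 1)^j·D·(2π)^{-M}·(2/N)^{M−j−2d}·2^d·∏ᵢ(1 + kᵢ²)⁻¹`. [cite: Grafakos2014, Thm. 3.3.9] -/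
theorem norm_mFourierCoeff_mul_weight_le_tail_prod {g : UnitAddTorus d → F} (hg : IsSmooth g) {M j : ℕ} (hM : 2 * Fintype.card d + j ≤ M) {D : ℝ}
    (hD : ∀ (i : d) (x : UnitAddTorus d), ‖((Torus.partialDeriv i)^[M] g) x‖ ≤ D) {N : ℕ} (hN : 1 ≤ N) {k : d → ℤ}
    (hk : ∃ i, (N : ℤ) ≤ 2 * |k i|) :
    ‖mFourierCoeff g k‖ * (1 + ∑ i, |(k i : ℝ)|) ^ j ≤
      ((Fintype.card d : ℝ) + 1) ^ j * (D / (2 * Real.pi) ^ M) * (2 / (N : ℝ)) ^ (M - j - 2 * Fintype.card d) *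
        (2 ^ Fintype.card d * ∏ i, (1 + (k i : ℝ) ^ 2)⁻¹) := by
  obtain ⟨i₀, hi₀⟩ := hk
  have hD0 : 0 ≤ D := le_trans (norm_nonneg _) (hD i₀ 0)
  have hd : Nonempty d := ⟨i₀⟩
  obtain ⟨j₀, -, hj₀⟩ := Finset.exists_max_image Finset.univ (fun j => |(k j : ℝ)|) (Finset.univ_nonempty_iff.2 hd)
  have hNR : (N : ℝ) / 2 ≤ |(k j₀ : ℝ)| := by
    have h1 : (N : ℝ) ≤ 2 * |(k i₀ : ℝ)| := by exact_mod_cast hi₀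
    have h2 := hj₀ i₀ (Finset.mem_univ _)
    linarith
  have hN1 : (1 : ℝ) ≤ N := by exact_mod_cast hN
  have hk0 : k j₀ ≠ 0 := by
    intro h
    rw [h, Int.cast_zero, abs_zero] at hNR
    linarith
  have hone : (1 : ℝ) ≤ |(k j₀ : ℝ)| := by exact_mod_cast Int.one_le_abs hk0
  have hpos : (0 : ℝ) < |(k j₀ : ℝ)| := by linarith
  set a : ℝ := |(k j₀ : ℝ)| with ha
  -- decay from the `M`-th partial derivative in direction `j₀`
  have h1 : ‖mFourierCoeff g k‖ ≤ D / (2 * Real.pi * a) ^ M :=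
    Torus.norm_mFourierCoeff_le_of_partialDeriv_iterate hg j₀ M hk0 (hD j₀)
  -- the weight against `j` powers of `a`
  have hw : (1 + ∑ i, |(k i : ℝ)|) ^ j ≤ ((Fintype.card d : ℝ) + 1) ^ j * a ^ j := by
    rw [← mul_pow]
    exact pow_le_pow_left₀ (by positivity) (one_add_sum_abs_le_mul_max k j₀ (fun j => hj₀ j (Finset.mem_univ j)) hone) j
  -- split `a^{-M}·a^j = a^{-(m)} · ∏ a^{-2}`, `m = M - j - 2d`
  set m : ℕ := M - j - 2 * Fintype.card d with hm
  have hMm : M = m + j + 2 * Fintype.card d := by omega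
  have hstep : ∀ i, (a ^ 2)⁻¹ ≤ 2 * (1 + (k i : ℝ) ^ 2)⁻¹ := by
    intro i
    refine le_trans ?_ (Torus.inv_max_sq_le_two_mul (k i))
    rw [inv_le_inv₀ (by positivity) (by positivity)]
    exact pow_le_pow_left₀ (by positivity) (max_le hone (hj₀ i (Finset.mem_univ i))) 2
  have htail : (a ^ m)⁻¹ ≤ (2 / (N : ℝ)) ^ m := by
    rw [← inv_pow, show (2 : ℝ) / N = ((N : ℝ) / 2)⁻¹ by rw [inv_div]]
    exact pow_le_pow_left₀ (by positivity) ((inv_le_inv₀ hpos (by positivity)).2 hNR) m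
  have hane : a ≠ 0 := hpos.ne'
  calc ‖mFourierCoeff g k‖ * (1 + ∑ i, |(k i : ℝ)|) ^ j
      ≤ D / (2 * Real.pi * a) ^ M * (((Fintype.card d : ℝ) + 1) ^ j * a ^ j) :=
        mul_le_mul h1 hw (by positivity) (by positivity)
    _ = ((Fintype.card d : ℝ) + 1) ^ j * (D / (2 * Real.pi) ^ M) * ((a ^ m)⁻¹ * ∏ _i : d, (a ^ 2)⁻¹) := by
        have key : a ^ M = a ^ m * a ^ j * (a ^ 2) ^ Fintype.card d := by
          rw [hMm, pow_add, pow_add, pow_mul]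
        rw [Finset.prod_const, Finset.card_univ, mul_pow, key, inv_pow]
        have h2 : (a ^ 2) ^ Fintype.card d ≠ 0 := pow_ne_zero _ (pow_ne_zero _ hane)
        have h3 : a ^ m ≠ 0 := pow_ne_zero _ hane
        have h3' : a ^ j ≠ 0 := pow_ne_zero _ hane
        have h4 : (2 * Real.pi) ^ M ≠ 0 := pow_ne_zero _ (by positivity)
        field_simp
    _ ≤ ((Fintype.card d : ℝ) + 1) ^ j * (D / (2 * Real.pi) ^ M) * ((2 / (N : ℝ)) ^ m * ∏ i : d, (2 * (1 + (k i : ℝ) ^ 2)⁻¹)) := by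
        refine mul_le_mul_of_nonneg_left (mul_le_mul htail (Finset.prod_le_prod (fun _ _ => by positivity) fun i _ => hstep i)
          (Finset.prod_nonneg fun _ _ => by positivity) (by positivity)) (by positivity)
    _ = ((Fintype.card d : ℝ) + 1) ^ j * (D / (2 * Real.pi) ^ M) * (2 / (N : ℝ)) ^ m *
          (2 ^ Fintype.card d * ∏ i, (1 + (k i : ℝ) ^ 2)⁻¹) := by
        rw [Finset.prod_mul_distrib, Finset.prod_const, Finset.card_univ]; ring

/-- The weighted tail series is summable (plumbing: on the tail region the weighted coefficient is below a summable product weight; off it the summand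
is `0`). [cite: Grafakos2014, §3.3.3] -/
theorem summable_tail_norm_mFourierCoeff_mul_weight {g : UnitAddTorus d → F} (hg : IsSmooth g) {M j : ℕ} (hM : 2 * Fintype.card d + j ≤ M)
    {D : ℝ} (hD : ∀ (i : d) (x : UnitAddTorus d), ‖((Torus.partialDeriv i)^[M] g) x‖ ≤ D) {N : ℕ} (hN : 1 ≤ N) :
    Summable fun k : d → ℤ => (if ∃ i, (N : ℤ) ≤ 2 * |k i| then ‖mFourierCoeff g k‖ * (1 + ∑ i, |(k i : ℝ)|) ^ j else 0) := by
  classical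
  rcases isEmpty_or_nonempty d with hd | ⟨⟨i₀⟩⟩
  · -- no coordinates: the tail condition `∃ i, …` is false, the summand is identically `0`
    refine (summable_zero (α := ℝ)).congr fun k => ?_
    rw [if_neg (fun ⟨i, _⟩ => IsEmpty.false i)]
  have hD0 : 0 ≤ D := le_trans (norm_nonneg _) (hD i₀ 0)
  have hsw : Summable fun k : d → ℤ => ∏ i, (1 + (k i : ℝ) ^ 2)⁻¹ :=
    Torus.summable_pi_prod_weight (d := d) (w := fun m : ℤ => (1 + (m : ℝ) ^ 2)⁻¹) summable_inv_one_add_sq_int (fun m => by positivity)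
  refine Summable.of_nonneg_of_le (fun k => by positivity) (fun k => ?_)
    (hsw.mul_left (((Fintype.card d : ℝ) + 1) ^ j * (D / (2 * Real.pi) ^ M) * (2 / (N : ℝ)) ^ (M - j - 2 * Fintype.card d) * 2 ^ Fintype.card d))
  split_ifs with hk
  · exact (norm_mFourierCoeff_mul_weight_le_tail_prod hg hM hD hN hk).trans (le_of_eq (by ring))
  · exact mul_nonneg (by positivity) (Finset.prod_nonneg fun _ _ => by positivity)

/-- **THE WEIGHTED TAIL BOUND.**  If `‖∂ᵢ^M g‖ ≤ D` for every coordinate `i` (`2d + j ≤ M`) and `N ≥ 1`, then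
`Σ_{k : ∃ i, N ≤ 2|kᵢ|} ‖𝓕g(k)‖·(1 + Σᵢ|kᵢ|)^j ≤ (card d + 1)^j·D·(2π)^{-M}·(2/N)^{M−j−2d}·2^d·Σ_{k ∈ ℤ^d} ∏ᵢ(1 + kᵢ²)⁻¹` — polynomial decay in the
threshold at the rate `N^{-(M−j−2d)}`. [cite: Grafakos2014, §3.3.3] -/
theorem tsum_tail_norm_mFourierCoeff_mul_weight_le [Nonempty d] {g : UnitAddTorus d → F} (hg : IsSmooth g) {M j : ℕ}
    (hM : 2 * Fintype.card d + j ≤ M) {D : ℝ} (hD : ∀ (i : d) (x : UnitAddTorus d), ‖((Torus.partialDeriv i)^[M] g) x‖ ≤ D)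
    {N : ℕ} (hN : 1 ≤ N) :
    ∑' k : d → ℤ, (if ∃ i, (N : ℤ) ≤ 2 * |k i| then ‖mFourierCoeff g k‖ * (1 + ∑ i, |(k i : ℝ)|) ^ j else 0) ≤
      ((Fintype.card d : ℝ) + 1) ^ j * (D / (2 * Real.pi) ^ M) * (2 / (N : ℝ)) ^ (M - j - 2 * Fintype.card d) *
        (2 ^ Fintype.card d * ∑' k : d → ℤ, ∏ i, (1 + (k i : ℝ) ^ 2)⁻¹) := by
  classical
  have hsw : Summable fun k : d → ℤ => ∏ i, (1 + (k i : ℝ) ^ 2)⁻¹ :=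
    Torus.summable_pi_prod_weight (d := d) (w := fun m : ℤ => (1 + (m : ℝ) ^ 2)⁻¹) summable_inv_one_add_sq_int (fun m => by positivity)
  obtain ⟨i₀⟩ := ‹Nonempty d›
  have hD0 : 0 ≤ D := le_trans (norm_nonneg _) (hD i₀ 0)
  have hpt : ∀ k : d → ℤ, (if ∃ i, (N : ℤ) ≤ 2 * |k i| then ‖mFourierCoeff g k‖ * (1 + ∑ i, |(k i : ℝ)|) ^ j else 0) ≤
      (((Fintype.card d : ℝ) + 1) ^ j * (D / (2 * Real.pi) ^ M) * (2 / (N : ℝ)) ^ (M - j - 2 * Fintype.card d) * 2 ^ Fintype.card d) *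
        ∏ i, (1 + (k i : ℝ) ^ 2)⁻¹ := by
    intro k
    split_ifs with hk
    · exact (norm_mFourierCoeff_mul_weight_le_tail_prod hg hM hD hN hk).trans (le_of_eq (by ring))
    · exact mul_nonneg (by positivity) (Finset.prod_nonneg fun _ _ => by positivity)
  refine (Summable.tsum_le_tsum hpt (summable_tail_norm_mFourierCoeff_mul_weight hg hM hD hN) (hsw.mul_left _)).trans (le_of_eq ?_)
  rw [tsum_mul_left]
  ring

end Literature.Analysis.Fourier

end
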